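import Mathlib
import HarnessLib
import Literature.MathematicalPhysics.StatisticalMechanics.FluctuationDefect
import Literature.MathematicalPhysics.StatisticalMechanics.StrongNormExpProduct

/-!
# Lipschitz bound of the fluctuation defect `D_B(H) = R_{k+1}e^{−H(B)} − e^{−(A_kH)(B)}`
# ([ABKM19] Theorem 6.8: `D_H S_k(0,0) = 0`, first-order/Lipschitz form)

`FluctuationDefect.tayNormLE_fluctDefect_abkm` shows `|D_B(H)|_{k,B} ≤ C‖H‖²_{k,0}`.  For the Lipschitz
estimate of the renormalisation map `S_k` one needs the corresponding bound on DIFFERENCES,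
`|D_B(H) − D_B(H')|_{k,B} ≤ C(‖H‖ + ‖H'‖)‖H − H'‖`.  With `Δ = H − H'` and `A = A_k` (linear),
`e^{−H} = e^{−H'}e^{−Δ}` gives the exact identity
`D_B(H) − D_B(H') = R_{k+1}[(e^{−H'(B)} − 1)(e^{−Δ(B)} − 1)] − (e^{−AH'(B)} − 1)(e^{−AΔ(B)} − 1) + D_B(Δ)`,
whose three terms are products of two small atoms (`StrongNormExpProduct`) or the second-order defect
of `Δ`; no Lipschitz form of the second-order exponential bound is needed.

* **`tayNormLE_fluctDefect_sub_abkm`** — for `‖H‖_{k,0}, ‖H'‖_{k,0} ≤ 1/64`: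
  `|D_B(H) − D_B(H')|_{k,B,T_φ} ≤ 512e^{1/4}(A_𝒫 + 4)(‖H‖ + ‖H'‖)‖H − H'‖ · w_{k:k+1}^B(φ)`.

Everything is proved; no named fact.

## References
* S. Adams, S. Buchholz, R. Kotecký, S. Müller, arXiv:1910.13564, Theorem 6.8 ((6.56), (6.61)–(6.64)),
  Lemma 9.3 [AdamsBuchholzKoteckyMuller2019].
-/

noncomputable section

namespace Literature.MathematicalPhysics.StatisticalMechanics.GradientRG

open scoped BigOperators
open Finset MeasureTheory
open Literature.MathematicalPhysics.QuantumFieldTheory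
open Literature.MathematicalPhysics.StatisticalMechanics.TorusPolymer
  (IsPolymer blockOf thicken isPolymer_blockOf card_blockOf subset_thicken blocks_blockOf
    card_blocks_eq_numBlocks numBlocks)
open Literature.Barriers.CriticalPhenomena.LongRangePhi4.Polymer (IsConn)

variable {d M : ℕ} [NeZero M]

/-- **Lipschitz bound of the fluctuation defect** for the torus data: on the block `B = B_x` at scale
`k ≤ N` (`d ≥ 2`, `L` odd, `M = L^N`, `AbkmWeightBounds` with `A_𝒫 ≥ 0`, `θ̄, λ, δ₀, δ₁ > 0`,
`h² ≥ h₀²`, `⌊d/2⌋+1 ≤ min(p, M_ord)`, shift `L^{dk}|γ_q| ≤ h²` for `γ = gradCov 𝒞_{k+1}`) and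
`‖H‖_{k,0}, ‖H'‖_{k,0} ≤ 1/64` (at `(𝔥_k, L^k, L^{dk})`):
`|D_B(H) − D_B(H')|_{k,B,T_φ} ≤ 512e^{1/4}(A_𝒫 + 4)(‖H‖_{k,0} + ‖H'‖_{k,0})‖H − H'‖_{k,0} · w_{k:k+1}^B(φ)`.
[cite: AdamsBuchholzKoteckyMuller2019, Theorem 6.8 ((6.56), (6.61)–(6.64))] -/
theorem tayNormLE_fluctDefect_sub_abkm {L N Mord R n p r₀ : ℕ} {θbar lam μ δ₁ δ₀ A𝒫 h A : ℝ}
    {𝒞 : ℕ → (Fin d → ZMod M) → ℝ} (hd : 2 ≤ d) (hθbar : 0 < θbar) (hlam : 0 < lam)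
    (hB : AbkmWeightBounds L N Mord R n θbar lam μ δ₁ δ₀ A𝒫 𝒞
      (abkmWeightData L N Mord R θbar (schedDelta δ₀ δ₁ N) 𝒞)) (hA𝒫 : 0 ≤ A𝒫)
    (hLodd : Odd L) (hM : M = L ^ N) {k : ℕ} (hk : k ≤ N) (hδ₀ : 0 < δ₀) (hδ₁ : 0 < δ₁) (hh : 0 < h)
    (hh0 : hZeroSq d R δ₀ δ₁ ≤ h ^ 2) (hMord : d / 2 + 1 ≤ Mord) (hp : d / 2 + 1 ≤ p)
    (hγ : ∀ q, ((L ^ (d * k) : ℕ) : ℝ) * |gradCov (𝒞 (k + 1)) q| ≤ h ^ 2)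
    (x : Fin d → ZMod M) {H H' : RelevantHamiltonian ℂ d}
    (hH : hamNorm (fieldWt h (L : ℝ) d k) ((L : ℝ) ^ k) (L ^ (d * k)) H ≤ 1 / 64)
    (hH' : hamNorm (fieldWt h (L : ℝ) d k) ((L : ℝ) ^ k) (L ^ (d * k)) H' ≤ 1 / 64) :
    TayNormLE ((abkmNormParams L N Mord R p r₀ h θbar A (schedDelta δ₀ δ₁ N) 𝒞).gauge k (blockOf (L ^ k) x))
      r₀ ((abkmWeightData L N Mord R θbar (schedDelta δ₀ δ₁ N) 𝒞).midWeight k (blockOf (L ^ k) x))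
      (fun φ => fluctDefect (𝒞 (k + 1)) H (blockOf (L ^ k) x) φ - fluctDefect (𝒞 (k + 1)) H' (blockOf (L ^ k) x) φ)
      (512 * Real.exp (1 / 4) * (A𝒫 + 4) *
        (hamNorm (fieldWt h (L : ℝ) d k) ((L : ℝ) ^ k) (L ^ (d * k)) H +
          hamNorm (fieldWt h (L : ℝ) d k) ((L : ℝ) ^ k) (L ^ (d * k)) H') *
        hamNorm (fieldWt h (L : ℝ) d k) ((L : ℝ) ^ k) (L ^ (d * k)) (H - H')) := by
  set P := abkmNormParams L N Mord R p r₀ h θbar A (schedDelta δ₀ δ₁ N) 𝒞 with hP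
  set W := abkmWeightData L N Mord R θbar (schedDelta δ₀ δ₁ N) 𝒞 with hW
  set B := blockOf (L ^ k) x with hBdef
  set Δ := H - H' with hΔ
  set 𝒸 := 𝒞 (k + 1) with h𝒸
  set AH' := stepOpA (gradCov 𝒸) H' with hAH'
  set AΔ := stepOpA (gradCov 𝒸) Δ with hAΔ
  set nH := hamNorm (fieldWt h (L : ℝ) d k) ((L : ℝ) ^ k) (L ^ (d * k)) H with hnH
  set nH' := hamNorm (fieldWt h (L : ℝ) d k) ((L : ℝ) ^ k) (L ^ (d * k)) H' with hnH'
  set nΔ := hamNorm (fieldWt h (L : ℝ) d k) ((L : ℝ) ^ k) (L ^ (d * k)) Δ with hnΔ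
  have hL0 : (0 : ℝ) < L := by exact_mod_cast hLodd.pos
  have hL1 : 1 ≤ L := hLodd.pos
  have hk' : k + 1 ≤ N + 1 := by omega
  obtain ⟨t, ht⟩ : ∃ t, N = k + t := ⟨N - k, by omega⟩
  have hMt : M = L ^ k * L ^ t := by rw [← pow_add, ← ht]; exact hM
  have hcard : B.card = L ^ (d * k) := by
    rw [hBdef, card_blockOf hMt hLodd.pow hLodd.pow x, ← pow_mul, mul_comm]
  have h𝔥 : 0 < fieldWt h (L : ℝ) d k := fieldWt_pos hh hL0 d k
  have hRk : (0 : ℝ) < (L : ℝ) ^ k := by positivity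
  have hnH0 : 0 ≤ nH := hamNorm_nonneg h𝔥.le hRk.le _ _
  have hnH'0 : 0 ≤ nH' := hamNorm_nonneg h𝔥.le hRk.le _ _
  have hnΔ0 : 0 ≤ nΔ := hamNorm_nonneg h𝔥.le hRk.le _ _
  have hnΔle : nΔ ≤ nH + nH' := hamNorm_sub_le h𝔥.le hRk.le _ H H'
  have hnΔ16 : nΔ ≤ 1 / 16 := by linarith
  -- norms of `A H'`, `A Δ`
  have hAH'2 : hamNorm (fieldWt h (L : ℝ) d k) ((L : ℝ) ^ k) (L ^ (d * k)) AH' ≤ 2 * nH' :=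
    hamNorm_stepOpA_abkm_le hd hL1 hh k hγ H'
  have hAΔ2 : hamNorm (fieldWt h (L : ℝ) d k) ((L : ℝ) ^ k) (L ^ (d * k)) AΔ ≤ 2 * nΔ :=
    hamNorm_stepOpA_abkm_le hd hL1 hh k hγ Δ
  have hBS : B ⊆ thicken (P.rad k) B := subset_thicken _ _
  have hgauge : P.gauge k B = fieldGauge (fieldWt h (L : ℝ) d k) ((L : ℝ) ^ k) p (thicken (P.rad k) B) := rfl
  -- weights: strong ≤ weak ≤ mid
  have hSW : ∀ φ, expWeight (strongCoef h N k • derivForm (L : ℝ) k (diffIndex d Mord)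
      (boxDensity (boxRad R L k) (boxWt (L : ℝ) d k) B)) φ ≤ W.weight k B φ :=
    fun φ => strongWeight_le_weight_abkm hB hδ₀ hδ₁ hh hh0 k (subset_refl B) φ
  have hwm : ∀ φ, W.weight k B φ ≤ W.midWeight k B φ := fun φ =>
    WeightData.weight_le_midWeight hB.dominated k B φ
  -- locality helpers
  have hev : ∀ G : RelevantHamiltonian ℂ d, IsGaugeLocal (P.gauge k B)
      (fun φ : (Fin d → ZMod M) → ℝ => eval G B φ) := fun G => by
    rw [hgauge]; exact isGaugeLocal_eval h𝔥.ne' hRk.ne' hp hBS G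
  have hexp_loc : ∀ G : RelevantHamiltonian ℂ d, IsGaugeLocal (P.gauge k B) (expNegH G B) :=
    fun G φ ψ hT => by simp only [expNegH, hev G φ ψ hT]
  have hexp_d : ∀ G : RelevantHamiltonian ℂ d, ContDiff ℝ r₀ (expNegH G B) := fun G => by
    show ContDiff ℝ r₀ (fun φ : (Fin d → ZMod M) → ℝ => Complex.exp (-(eval G B φ)))
    exact (contDiff_eval G B (n := r₀)).neg.cexp
  have hsub1_d : ∀ G : RelevantHamiltonian ℂ d, ContDiff ℝ r₀ (fun φ => expNegH G B φ - 1) :=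
    fun G => (hexp_d G).sub contDiff_const
  have hsub1_loc : ∀ G : RelevantHamiltonian ℂ d, IsGaugeLocal (P.gauge k B) (fun φ => expNegH G B φ - 1) :=
    fun G φ ψ hT => by simp only [expNegH, hev G φ ψ hT]
  -- the block, polymer facts
  have hMo : Odd M := by rw [hM]; exact hLodd.pow
  have hBpoly : IsPolymer (L ^ k) B := isPolymer_blockOf _ x
  have hnB : numBlocks (L ^ k) B = 1 := by
    rw [← card_blocks_eq_numBlocks, hBdef, blocks_blockOf, card_singleton]
  have hC := posSemidef_circulant_abkm hB hk'
  have hdom := weightSectionDominated_abkm hθbar hlam hB hk' B (P.gauge k B)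
  -- (1) the product `(e^{−H'} − 1)(e^{−Δ} − 1)` and its fluctuation integral
  set Pr : ((Fin d → ZMod M) → ℝ) → ℂ := fun ψ => (expNegH H' B ψ - 1) * (expNegH Δ B ψ - 1) with hPr
  have hH'B : hamNorm (fieldWt h (L : ℝ) d k) ((L : ℝ) ^ k) B.card H' ≤ 1 / 16 := by rw [hcard]; linarith
  have hΔB : hamNorm (fieldWt h (L : ℝ) d k) ((L : ℝ) ^ k) B.card Δ ≤ 1 / 16 := by rw [hcard]; exact hnΔ16
  have hPr_s := tayNormLE_expNegH_sub_one_mul_strong_abkm (R := R) (Mord := Mord) hd hLodd hM hk hh hMord hp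
    hBS r₀ hH'B hΔB
  rw [← hgauge, hcard] at hPr_s
  have hc1 : 0 ≤ 256 * Real.exp (1 / 4) * nH' * nΔ := by positivity
  have hPr_w : TayNormLE (P.gauge k B) r₀ (W.weight k B) Pr (256 * Real.exp (1 / 4) * nH' * nΔ) :=
    hPr_s.mono_weight hc1 hSW
  have hPr_d : ContDiff ℝ r₀ Pr := (hsub1_d H').mul (hsub1_d Δ)
  have hPr_loc : IsGaugeLocal (P.gauge k B) Pr := (hsub1_loc H').mul (hsub1_loc Δ)
  have hRPr : TayNormLE (P.gauge k B) r₀ (W.midWeight k B) (fluct 𝒸 Pr)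
      (256 * Real.exp (1 / 4) * nH' * nΔ * A𝒫) := by
    have h1 := integrationProperty_abkm hθbar hlam hB hk' p r₀ h A B hBpoly
      (TorusPolymer.isConn_blockOf hMo hLodd.pow x) Pr _ hc1 hPr_d hPr_loc hPr_w
    have e : numBlocks (P.L ^ k) B = 1 := hnB
    rw [e, pow_one] at h1
    exact h1
  have hRPr_d : ContDiff ℝ r₀ (fluct 𝒸 Pr) :=
    contDiff_fluct_abkm hθbar hlam hB hk' B (P.gauge k B) hc1 hPr_d hPr_loc hPr_w
  -- (2) the product `(e^{−AH'} − 1)(e^{−AΔ} − 1)`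
  set Pa : ((Fin d → ZMod M) → ℝ) → ℂ := fun ψ => (expNegH AH' B ψ - 1) * (expNegH AΔ B ψ - 1) with hPa
  have hAH'B : hamNorm (fieldWt h (L : ℝ) d k) ((L : ℝ) ^ k) B.card AH' ≤ 1 / 16 := by rw [hcard]; linarith
  have hAΔB : hamNorm (fieldWt h (L : ℝ) d k) ((L : ℝ) ^ k) B.card AΔ ≤ 1 / 16 := by rw [hcard]; linarith
  have hPa_s := tayNormLE_expNegH_sub_one_mul_strong_abkm (R := R) (Mord := Mord) hd hLodd hM hk hh hMord hp
    hBS r₀ hAH'B hAΔB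
  rw [← hgauge, hcard] at hPa_s
  have hc2 : 0 ≤ 256 * Real.exp (1 / 4) * hamNorm (fieldWt h (L : ℝ) d k) ((L : ℝ) ^ k) (L ^ (d * k)) AH' *
      hamNorm (fieldWt h (L : ℝ) d k) ((L : ℝ) ^ k) (L ^ (d * k)) AΔ := by
    have := hamNorm_nonneg h𝔥.le hRk.le (L ^ (d * k)) AH'
    have := hamNorm_nonneg h𝔥.le hRk.le (L ^ (d * k)) AΔ
    positivity
  have hPa_w : TayNormLE (P.gauge k B) r₀ (W.midWeight k B) Pa
      (256 * Real.exp (1 / 4) * hamNorm (fieldWt h (L : ℝ) d k) ((L : ℝ) ^ k) (L ^ (d * k)) AH' *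
        hamNorm (fieldWt h (L : ℝ) d k) ((L : ℝ) ^ k) (L ^ (d * k)) AΔ) :=
    (hPa_s.mono_weight hc2 hSW).mono_weight hc2 hwm
  have hPa_d : ContDiff ℝ r₀ Pa := (hsub1_d AH').mul (hsub1_d AΔ)
  -- (3) the defect of `Δ`
  have hDΔ := tayNormLE_fluctDefect_abkm (p := p) (r₀ := r₀) (A := A) hd hθbar hlam hB hLodd hM hk hδ₀ hδ₁ hh
    hh0 hMord hp hγ x (H := Δ) hnΔ16
  have hc3 : 0 ≤ 256 * Real.exp (1 / 4) * (A𝒫 + 4) * nΔ ^ 2 := by positivity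
  -- integrability and the identity
  have hexp_s : ∀ G : RelevantHamiltonian ℂ d, hamNorm (fieldWt h (L : ℝ) d k) ((L : ℝ) ^ k) B.card G ≤ 1 / 8 →
      ∀ φ, Integrable (fun ξ => expNegH G B (φ + ξ)) (stepMeasure 𝒸) := by
    intro G hG φ
    have hs := tayNormLE_expNegH_strong_abkm (R := R) (Mord := Mord) hd hLodd hM hk hh hMord hp hBS r₀ hG
    rw [← hgauge] at hs
    exact integrable_comp_add_of_tayNormLE (hs.mono_weight (Real.exp_pos _).le hSW) (Real.exp_pos _).le
      (hexp_d G) (hexp_loc G) hdom φ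
  have hIH' := hexp_s H' (by linarith)
  have hIΔ := hexp_s Δ (by linarith)
  have hIPr : ∀ φ, Integrable (fun ξ => Pr (φ + ξ)) (stepMeasure 𝒸) := fun φ =>
    integrable_comp_add_of_tayNormLE hPr_w hc1 hPr_d hPr_loc hdom φ
  have hDΔ_d : ContDiff ℝ r₀ (fluctDefect 𝒸 Δ B) := by
    have hs := tayNormLE_expNegH_strong_abkm (R := R) (Mord := Mord) hd hLodd hM hk hh hMord hp hBS r₀
      (show hamNorm (fieldWt h (L : ℝ) d k) ((L : ℝ) ^ k) B.card Δ ≤ 1 / 8 by linarith)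
    rw [← hgauge] at hs
    have h1 : ContDiff ℝ r₀ (fluct 𝒸 (expNegH Δ B)) :=
      contDiff_fluct_abkm hθbar hlam hB hk' B (P.gauge k B) (Real.exp_pos _).le (hexp_d Δ) (hexp_loc Δ)
        (hs.mono_weight (Real.exp_pos _).le hSW)
    show ContDiff ℝ r₀ (fun φ => fluct 𝒸 (expNegH Δ B) φ - expNegH (stepOpA (gradCov 𝒸) Δ) B φ)
    exact h1.sub (hexp_d _)
  haveI := isProbabilityMeasure_stepMeasure 𝒸
  have hHsum : H = H' + Δ := by rw [hΔ]; abel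
  have heq : (fun φ => fluctDefect 𝒸 H B φ - fluctDefect 𝒸 H' B φ) =
      fluct 𝒸 Pr + ((-1 : ℝ) • Pa + fluctDefect 𝒸 Δ B) := by
    funext φ
    simp only [Pi.add_apply, neg_one_smul]
    -- pointwise factorisations
    have hfacH : ∀ ψ, expNegH H B ψ = expNegH H' B ψ * expNegH Δ B ψ := fun ψ => by
      simp only [expNegH]
      rw [hHsum, eval_add, neg_add, Complex.exp_add]
    have hfacA : ∀ ψ, expNegH (stepOpA (gradCov 𝒸) H) B ψ = expNegH AH' B ψ * expNegH AΔ B ψ := fun ψ => by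
      simp only [expNegH, hAH', hAΔ]
      rw [hHsum, stepOpA_add, eval_add, neg_add, Complex.exp_add]
    -- the fluctuation integral of `e^{−H}`
    have hint : fluct 𝒸 (expNegH H B) φ = fluct 𝒸 Pr φ + fluct 𝒸 (expNegH Δ B) φ + fluct 𝒸 (expNegH H' B) φ - 1 := by
      unfold fluct
      have hptw : ∀ ξ, expNegH H B (φ + ξ) =
          Pr (φ + ξ) + (expNegH Δ B (φ + ξ) + (expNegH H' B (φ + ξ) - 1)) := fun ξ => by
        rw [hfacH]; simp only [hPr]; ring
      simp_rw [hptw]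
      have i3 : Integrable (fun ξ => expNegH H' B (φ + ξ) - 1) (stepMeasure 𝒸) :=
        (hIH' φ).sub (integrable_const _)
      have i23 : Integrable (fun ξ => expNegH Δ B (φ + ξ) + (expNegH H' B (φ + ξ) - 1)) (stepMeasure 𝒸) :=
        (hIΔ φ).add i3
      rw [integral_add (hIPr φ) i23, integral_add (hIΔ φ) i3, integral_sub (hIH' φ) (integrable_const _)]
      simp only [integral_const, probReal_univ, one_smul]
      ring
    show fluctDefect 𝒸 H B φ - fluctDefect 𝒸 H' B φ = fluct 𝒸 Pr φ + (-(Pa φ) + fluctDefect 𝒸 Δ B φ)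
    unfold fluctDefect
    rw [hint, hfacA, ← hAH', ← hAΔ]
    simp only [hPa]
    ring
  rw [heq]
  -- combine the three bounds
  have hsum := (hRPr.add ((hPa_w.smul hPa_d (-1)).add hDΔ (hPa_d.const_smul (-1 : ℝ)) hDΔ_d) hRPr_d
    ((hPa_d.const_smul (-1 : ℝ)).add hDΔ_d))
  refine hsum.mono ?_ (fun φ => (W.midWeight_pos k B φ).le)
  rw [abs_neg, abs_one, one_mul]
  have hAprod : hamNorm (fieldWt h (L : ℝ) d k) ((L : ℝ) ^ k) (L ^ (d * k)) AH' *
      hamNorm (fieldWt h (L : ℝ) d k) ((L : ℝ) ^ k) (L ^ (d * k)) AΔ ≤ (2 * nH') * (2 * nΔ) :=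
    mul_le_mul hAH'2 hAΔ2 (hamNorm_nonneg h𝔥.le hRk.le _ _) (by positivity)
  have he : 0 ≤ 256 * Real.exp (1 / 4) := by positivity
  have hsq : nΔ ^ 2 ≤ (nH + nH') * nΔ := by rw [sq]; exact mul_le_mul_of_nonneg_right hnΔle hnΔ0
  have hA4 : 0 ≤ A𝒫 + 4 := by linarith
  nlinarith [mul_le_mul_of_nonneg_left hAprod he, mul_le_mul_of_nonneg_left hsq (mul_nonneg he hA4),
    mul_nonneg (mul_nonneg he hA𝒫) (mul_nonneg hnH0 hnΔ0), mul_nonneg he (mul_nonneg hnH'0 hnΔ0),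
    mul_nonneg (mul_nonneg he hA𝒫) (mul_nonneg hnH'0 hnΔ0), mul_nonneg he (mul_nonneg hnH0 hnΔ0)]

end Literature.MathematicalPhysics.StatisticalMechanics.GradientRG

end
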